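import Literature.Computability.AlgebraicComplexity.MatMulRankLowerBoundsProofs
import Literature.Computability.AlgebraicComplexity.LandsbergMichalekKoszul
import Literature.Barriers.ValiantsHypothesis.ShiftedPartialDerivatives
import HarnessLib

/-!
# Koszul–Young flattenings of polynomials (Landsberg–Ottaviani): the rank `rank P_{k,d-k}^{∧p}`

Topic `Literature/Computability/AlgebraicComplexity`. A DEFINITION file (cell `pub-gct-max`, track F/T,
definition item F-4a; requested for typing engine-3's located negative on Koszul–Young flattenings of the
padded permanent). Everything here is a definition or PROVED; no named facts.

**The printed notion.** For a form `P ∈ S^dV` the *(polynomial) Koszul(–Young) flattening* is the linear map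

  `P_{k,d-k}^{∧p} : S^kV^* ⊗ Λ^pV → S^{d-k-1}V ⊗ Λ^{p+1}V`

obtained from the classical flattening (catalecticant) `P_{k,d-k} : S^kV^* → S^{d-k}V`, `D ↦ D(P)`, by
tensoring with `Id_{Λ^pV}`, including `S^{d-k}V ⊂ S^{d-k-1}V ⊗ V` and skew-symmetrising `V ⊗ Λ^pV → Λ^{p+1}V`
[cite: LandsbergGCT2017, §8.2.1 eq. (8.2.1) (held PDF p. 221)]; equivalently (Guan) the composition of
`P_{k,d-k} ⊗ Id_{Λ^pV}` with the "algebraic exterior derivative"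
`∧_{d-k,p} : S^{d-k}V ⊗ Λ^pV → S^{d-k-1}V ⊗ Λ^{p+1}V`,
`l₁⋯l_{d-k} ⊗ m₁∧⋯∧m_p ↦ ∑_s l₁⋯l̂_s⋯l_{d-k} ⊗ l_s ∧ m₁ ∧ ⋯ ∧ m_p`, i.e. `Q ⊗ ω ↦ ∑_i ∂_iQ ⊗ (x_i ∧ ω)`
[cite: Guan2016, §1.3 (definition of `P_{k,d-k}^{∧p}`)]. It is the Young flattening `𝓕_{λ,μ}(P)` of
Landsberg–Ottaviani / Farnsworth for the hook shapes [cite: Farnsworth2016, Def. 2.3 and Prop. 2.4], and its use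
is Landsberg's Prop. 8.2.1.1: if the map attached to `x^d` has rank `r₀` and the map attached to `P` has rank
`r`, then the symmetric border rank satisfies `R̲_S(P) ≥ r / r₀` [cite: LandsbergGCT2017, Prop. 8.2.1.1 (held PDF p. 221)];
for the Koszul flattening `r₀ = rank((x^d)_{k,d-k}^{∧p}) = binom(dim V - 1, p)` (the image is
`x^{d-k-1} ⊗ (x ∧ Λ^pV)`) [cite: Guan2016, Lemma 2.9] — proved below as `kyRankFin_X_pow`.
By lower semicontinuity and `End(V)`-equivariance the rank is also an obstruction to orbit-closure
membership (`P ∈ \overline{GL·Q} ⇒ rank P^{∧p}_{k,d-k} ≤ rank Q^{∧p}_{k,d-k}`), the use made of it for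
`perm_m` versus `det_n` (Landsberg–Ottaviani 2015 Rem. 1.5 for tensors; ELSW 2018 Rem. 1.3–1.4 for the
symmetric cousins); that soundness statement is NOT vendored here (no named facts in this file).

**Rendering (coordinates).** `V = K^q` with basis `x_0, …, x_{q-1}` (`MvPolynomial (Fin q) K`), `Λ^•K^q` with
basis `e_S`, `S ⊆ Fin q` (the tree's `PSub`/`wedgeMatrix`/`koszulSign` of `MatMulRankLowerBoundsProofs.lean`),
differential operators `∂^l = ∂_{l₁}⋯∂_{l_k}` indexed by lists of variables (the tree's `iterPDeriv` of
`ShiftedPartialDerivatives.lean`; lists over-parametrise the monomial basis of `S^kV^*`, which does not change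
spans). The image of the basis tensor `∂^l ⊗ e_S` is
`∑_{i ∉ S} ε(S,i) · ∂_i∂^l P ⊗ e_{S ∪ {i}}` (`kyImage`, literally column `S` of the tree's `wedgeMatrix` of the
gradient vector `(∂_i ∂^l P)_i` with polynomial entries), and **`kyRankFin K p k P` is the rank of
`P_{k,d-k}^{∧p}`, i.e. the dimension of the span of these images** (as `shiftedPartialsRank` is defined for the
Hilbert flattening). No normalising factor `1/(d-k)` is inserted (Landsberg's inclusion `S^{d-k}V ⊂ S^{d-k-1}V⊗V`
is the polarisation; over a field of characteristic `0` the rank is the same). The degree `d` is not an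
argument: for a form of degree `d` the images lie in degree `d - k - 1` automatically, and for `k ≥ d` the
map and the rank are `0`. For a polynomial ring on an arbitrary finite variable type `σ` the variables are
numbered by `Fintype.equivFin σ` (`kyRank`); the number does not depend on the numbering (a permutation of the
coordinates maps `e_S` to `± e_{π S}`, a signed permutation of the basis of `Λ^•`, and `∂^l ⊗ e_S` to
`± ∂^{π l} ⊗ e_{π S}`): PROVED below as `kyRankFin_rename` (invariance under every permutation of `Fin q`) and
`kyRank_eq_kyRankFin_rename` (any bijection `σ ≃ Fin (card σ)` gives the same number).

**What is here.** `kyImage`, `kyImages`, `kyRankFin`, `kyRank` (definitions); unfolding lemmas; `kyRankFin_zero`;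
the gradient of an iterated derivative of a pure power (`pderiv_iterPDeriv_X_pow`); the rank-one value **`kyRankFin_X_pow`:
`rank((x_i^d)_{k,d-k}^{∧p}) = binom(q - 1, p)` for `k < d` in characteristic `0`** (Guan Lemma 2.9 = Landsberg's
`r₀`); and the invariance of the rank under renumbering the variables (`invCount`, `renameSign`,
`koszulSign_map_mul` — the Koszul sign versus the signed permutation `Λ(π)`; `kyImage_rename`, `renameKY`,
`kyRankFin_rename`, `kyRank_eq_kyRankFin_rename`). NOT here: the matrix form with a Fintype monomial basis (for
kernel certificates), invariance/monotonicity under general linear substitutions (`GL`/`End`), semicontinuity /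
orbit-closure monotonicity, and any value on `det_n` / `perm_m` (Farnsworth 2016 Thms. 1.6, 1.8 are computer
calculations).

## References
* [LandsbergGCT2017] J. M. Landsberg, *Geometry and Complexity Theory*, CUP 2017, §8.2.1, eq. (8.2.1) and
  Prop. 8.2.1.1 (held PDF p. 221).
* [Guan2016] Y. Guan, *Flattenings and Koszul Young flattenings arising in complexity theory*,
  Comm. Algebra 45 (2017) 4002–4017 (arXiv:1510.00886, whose numbering §1.3 / Lemma 2.9 is used here).
* [Farnsworth2016] C. Farnsworth, *Koszul–Young flattenings and symmetric border rank of the determinant*,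
  J. Algebra 447 (2016) 664–676 (arXiv:1505.05079), Def. 2.3, Prop. 2.4.
* [LandsbergOttaviani2011] J. M. Landsberg, G. Ottaviani, *Equations for secant varieties of Veronese and other
  varieties*, Ann. Mat. Pura Appl. 192 (2013) 569–606, §4 (Young flattenings; the bound `rank ≤ r·t` is its
  Prop. 4.1 as cited by Farnsworth 2016, Prop. 2.4 — not opened here).
-/

noncomputable section

open MvPolynomial Finset
open scoped BigOperators

namespace Literature.Computability.AlgebraicComplexity

open Literature.Barriers.ValiantsHypothesis (iterPDeriv iterPDeriv_nil iterPDeriv_cons)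

/-! ## Definitions -/

section Defs

variable {K : Type*} [CommRing K] {q : ℕ}

/-- The image of the basis tensor `∂^l ⊗ e_S ∈ S^kV^* ⊗ Λ^pV` (`l` a list of `k` variables,
`e_S = e_{s₁} ∧ ⋯ ∧ e_{s_p}` for `S = {s₁ < ⋯ < s_p} ⊆ Fin q`) under the Koszul–Young flattening of `f`:
`∑_{i ∉ S} ε(S,i) · ∂_i ∂^l f ⊗ e_{S ∪ {i}} ∈ K[x] ⊗ Λ^{p+1}K^q`, written as the coefficient function
`T ↦ (coefficient of e_T)`, i.e. column `S` of the tree's `wedgeMatrix` of the gradient `(∂_i ∂^l f)_i`.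
[cite: Guan2016, §1.3 (definition of `P_{k,d-k}^{∧p}`: `Q ⊗ ω ↦ ∑_s ∂ Q ⊗ l_s ∧ ω`)]
[cite: LandsbergGCT2017, §8.2.1 eq. (8.2.1)] -/
def kyImage (f : MvPolynomial (Fin q) K) (l : List (Fin q)) (S : Finset (Fin q)) :
    Finset (Fin q) → MvPolynomial (Fin q) K :=
  fun T => wedgeMatrix (fun i => pderiv i (iterPDeriv l f)) T S

/-- Unfolding lemma for `kyImage`: the coefficient of `e_T` is
`∑_j [j ∉ S, T = S ∪ {j}] ε(S,j) ∂_j ∂^l f`. [cite: Guan2016, §1.3] -/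
theorem kyImage_apply (f : MvPolynomial (Fin q) K) (l : List (Fin q)) (S T : Finset (Fin q)) :
    kyImage f l S T =
      ∑ j, if j ∉ S ∧ T = insert j S then
        (koszulSign S j : MvPolynomial (Fin q) K) * pderiv j (iterPDeriv l f) else 0 := rfl

/-- The images of ALL basis tensors `∂^l ⊗ e_S` with `|l| = k`, `|S| = p`: a spanning set of the image of
`f_{k,d-k}^{∧p} : S^kV^* ⊗ Λ^pV → S^{d-k-1}V ⊗ Λ^{p+1}V`. [cite: Guan2016, §1.3] [cite: LandsbergGCT2017, §8.2.1 eq. (8.2.1)] -/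
def kyImages (p k : ℕ) (f : MvPolynomial (Fin q) K) : Set (Finset (Fin q) → MvPolynomial (Fin q) K) :=
  {g | ∃ (l : List (Fin q)) (S : Finset (Fin q)), l.length = k ∧ S.card = p ∧ g = kyImage f l S}

/-- Membership in `kyImages`, unfolded. [cite: Guan2016, §1.3] -/
theorem mem_kyImages_iff {p k : ℕ} {f : MvPolynomial (Fin q) K} {g : Finset (Fin q) → MvPolynomial (Fin q) K} :
    g ∈ kyImages p k f ↔
      ∃ (l : List (Fin q)) (S : Finset (Fin q)), l.length = k ∧ S.card = p ∧ g = kyImage f l S :=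
  Iff.rfl

end Defs

/-- **`rank(f_{k,d-k}^{∧p})`**, the rank of the Koszul–Young flattening
`S^kV^* ⊗ Λ^pV → S^{d-k-1}V ⊗ Λ^{p+1}V` of `f ∈ K[x_0,…,x_{q-1}]` (`V = K^q`): the dimension of its image,
the span of the images `kyImage f l S` (`|l| = k`, `|S| = p`) of the basis tensors. Over a field, as a
natural number. [cite: LandsbergGCT2017, §8.2.1 eq. (8.2.1) and Prop. 8.2.1.1] [cite: Guan2016, §1.3] -/
def kyRankFin (K : Type*) [Field K] {q : ℕ} (p k : ℕ) (f : MvPolynomial (Fin q) K) : ℕ :=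
  Module.finrank K (Submodule.span K (kyImages p k f))

/-- The Koszul–Young flattening rank of a polynomial in finitely many variables of any index type `σ`,
after numbering the variables by `Fintype.equivFin σ` (the value does not depend on the numbering: a
permutation of coordinates acts on the bases `e_S`, `∂^l ⊗ e_S` by signed permutations).
[cite: LandsbergGCT2017, §8.2.1 eq. (8.2.1)] [cite: Guan2016, §1.3] -/
def kyRank (K : Type*) [Field K] {σ : Type*} [Fintype σ] [DecidableEq σ] (p k : ℕ)
    (f : MvPolynomial σ K) : ℕ :=
  kyRankFin K p k (rename (Fintype.equivFin σ) f)

/-- Unfolding lemma for `kyRank`. [cite: LandsbergGCT2017, §8.2.1 eq. (8.2.1)] -/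
theorem kyRank_def (K : Type*) [Field K] {σ : Type*} [Fintype σ] [DecidableEq σ] (p k : ℕ)
    (f : MvPolynomial σ K) :
    kyRank K p k f = kyRankFin K p k (rename (Fintype.equivFin σ) f) := rfl

/-! ## Elementary properties -/

section Basic

variable {K : Type*} [CommRing K] {q : ℕ}

/-- Iterated derivatives of `0` vanish (restated over a `CommRing`; the tree's `iterPDeriv_zero'` lives in a
heavier file). [folklore] -/
private theorem iterPDeriv_zero_poly {σ : Type*} (l : List σ) : iterPDeriv l (0 : MvPolynomial σ K) = 0 := by
  induction l with
  | nil => rfl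
  | cons v l ih => rw [iterPDeriv_cons, ih, map_zero]

/-- The Koszul–Young images of the zero polynomial vanish (the map (8.2.1) is linear in `P`).
[cite: LandsbergGCT2017, §8.2.1 (eq. (8.2.1) "viewed as a map `S^dV ⊗ (S^kV^* ⊗ Λ^pV) → S^{d-k-1}V ⊗ Λ^{p+1}V`")] -/
@[simp] theorem kyImage_zero (l : List (Fin q)) (S : Finset (Fin q)) :
    kyImage (0 : MvPolynomial (Fin q) K) l S = 0 := by
  funext T
  rw [kyImage, iterPDeriv_zero_poly]
  simp only [map_zero]
  rw [show (fun _ : Fin q => (0 : MvPolynomial (Fin q) K)) = 0 from rfl, wedgeMatrix_zero]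
  rfl

end Basic

section Field

variable {K : Type*} [Field K] {q : ℕ}

/-- `rank(0_{k,d-k}^{∧p}) = 0` (the map (8.2.1) is linear in `P`).
[cite: LandsbergGCT2017, §8.2.1 (eq. (8.2.1) "viewed as a map `S^dV ⊗ (S^kV^* ⊗ Λ^pV) → S^{d-k-1}V ⊗ Λ^{p+1}V`")] -/
theorem kyRankFin_zero (p k : ℕ) : kyRankFin K p k (0 : MvPolynomial (Fin q) K) = 0 := by
  rw [kyRankFin]
  have : Submodule.span K (kyImages p k (0 : MvPolynomial (Fin q) K)) = ⊥ := by
    rw [Submodule.span_eq_bot]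
    rintro g ⟨l, S, -, -, rfl⟩
    exact kyImage_zero l S
  rw [this, finrank_bot]

end Field

/-! ## The rank-one value: `rank((x_i^d)_{k,d-k}^{∧p}) = binom(q - 1, p)` -/

section PurePower

variable {K : Type*} [Field K] {q : ℕ}

/-- `∂^l (x_i^d) = d(d-1)⋯(d-|l|+1) · x_i^{d-|l|}` if every letter of `l` is `i`, and `0` otherwise
(the derivatives of a pure power `l^d`, first step of Guan's rank-one computation). [cite: Guan2016, Lemma 2.9 (proof)] -/
theorem iterPDeriv_X_pow (i : Fin q) (d : ℕ) (l : List (Fin q)) :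
    iterPDeriv l ((X i : MvPolynomial (Fin q) K) ^ d) =
      if ∀ j ∈ l, j = i then (d.descFactorial l.length : K) • X i ^ (d - l.length) else 0 := by
  induction l with
  | nil => simp
  | cons j l ih =>
    rw [iterPDeriv_cons, ih, List.length_cons]
    by_cases h : ∀ j' ∈ l, j' = i
    · rw [if_pos h]
      by_cases hj : j = i
      · have hc : ∀ j' ∈ j :: l, j' = i := fun j' hj' =>
          (List.mem_cons.1 hj').elim (fun e => e.trans hj) (h j')
        rw [if_pos hc, hj, Derivation.map_smul, Derivation.leibniz_pow, pderiv_X_self, smul_eq_mul,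
          mul_one, ← Nat.cast_smul_eq_nsmul K, smul_smul, Nat.descFactorial_succ, Nat.cast_mul, mul_comm,
          Nat.sub_sub]
      · have hc : ¬ ∀ j' ∈ j :: l, j' = i := fun h' => hj (h' j List.mem_cons_self)
        rw [if_neg hc, Derivation.map_smul, Derivation.leibniz_pow, pderiv_X_of_ne (fun h' => hj h'.symm),
          smul_zero, smul_zero, smul_zero]
    · have hc : ¬ ∀ j' ∈ j :: l, j' = i := fun h' => h fun j' hj' => h' j' (List.mem_cons_of_mem j hj')
      rw [if_neg h, map_zero, if_neg hc]

/-- The gradient of an iterated derivative of a pure power: `∂_j ∂^l (x_i^d)` is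
`d(d-1)⋯(d-|l|) · x_i^{d-|l|-1}` if `j = i` and all letters of `l` are `i`, else `0` (Guan's rank-one
computation, gradient step). [cite: Guan2016, Lemma 2.9 (proof)] -/
theorem pderiv_iterPDeriv_X_pow (i j : Fin q) (d : ℕ) (l : List (Fin q)) :
    pderiv j (iterPDeriv l ((X i : MvPolynomial (Fin q) K) ^ d)) =
      if (∀ j' ∈ l, j' = i) ∧ j = i then
        (d.descFactorial (l.length + 1) : K) • X i ^ (d - (l.length + 1)) else 0 := by
  rw [← iterPDeriv_cons, iterPDeriv_X_pow, List.length_cons]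
  by_cases h : (∀ j' ∈ l, j' = i) ∧ j = i
  · have hc : ∀ j' ∈ j :: l, j' = i := fun j' hj' =>
      (List.mem_cons.1 hj').elim (fun e => e.trans h.2) (h.1 j')
    rw [if_pos h, if_pos hc]
  · have hc : ¬ ∀ j' ∈ j :: l, j' = i := fun h' =>
      h ⟨fun j' hj' => h' j' (List.mem_cons_of_mem j hj'), h' j List.mem_cons_self⟩
    rw [if_neg h, if_neg hc]

/-- The Koszul–Young images of a pure power: `∂^l ⊗ e_S ↦ ε(S,i) d(d-1)⋯(d-|l|) · x_i^{d-|l|-1} ⊗ e_{S ∪ {i}}`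
when all letters of `l` are `i` and `i ∉ S`, and `0` otherwise (Guan: "the image is
span`{l^{d-k-1} ⊗ (l ∧ x_{i₁} ∧ ⋯ ∧ x_{i_p})}`"). [cite: Guan2016, Lemma 2.9 (proof)] -/
theorem kyImage_X_pow (i : Fin q) (d : ℕ) (l : List (Fin q)) (S : Finset (Fin q)) :
    kyImage ((X i : MvPolynomial (Fin q) K) ^ d) l S =
      if (∀ j ∈ l, j = i) ∧ i ∉ S then
        Pi.single (insert i S) ((koszulSign S i : MvPolynomial (Fin q) K) *
          ((d.descFactorial (l.length + 1) : K) • X i ^ (d - (l.length + 1))))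
      else 0 := by
  funext T
  unfold kyImage
  by_cases h : ∀ j ∈ l, j = i
  · have hv : (fun j => pderiv j (iterPDeriv l ((X i : MvPolynomial (Fin q) K) ^ d))) =
        Pi.single i ((d.descFactorial (l.length + 1) : K) • X i ^ (d - (l.length + 1))) := by
      funext j
      rw [pderiv_iterPDeriv_X_pow, Pi.single_apply]
      by_cases hj : j = i
      · rw [if_pos (show (∀ j' ∈ l, j' = i) ∧ j = i from ⟨h, hj⟩), if_pos hj]
      · rw [if_neg (show ¬((∀ j' ∈ l, j' = i) ∧ j = i) from fun h' => hj h'.2), if_neg hj]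
    rw [hv, wedgeMatrix_single]
    by_cases hiS : i ∈ S
    · rw [if_neg (show ¬(i ∉ S ∧ T = insert i S) from fun h' => h'.1 hiS),
        if_neg (show ¬((∀ j ∈ l, j = i) ∧ i ∉ S) from fun h' => h'.2 hiS), Pi.zero_apply]
    · rw [if_pos (show (∀ j ∈ l, j = i) ∧ i ∉ S from ⟨h, hiS⟩), Pi.single_apply]
      by_cases hT : T = insert i S
      · rw [if_pos (show i ∉ S ∧ T = insert i S from ⟨hiS, hT⟩), if_pos hT]
      · rw [if_neg (show ¬(i ∉ S ∧ T = insert i S) from fun h' => hT h'.2), if_neg hT]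
  · have hv : (fun j => pderiv j (iterPDeriv l ((X i : MvPolynomial (Fin q) K) ^ d))) = 0 := by
      funext j
      rw [pderiv_iterPDeriv_X_pow, if_neg (show ¬((∀ j' ∈ l, j' = i) ∧ j = i) from fun h' => h h'.1),
        Pi.zero_apply]
    rw [hv, wedgeMatrix_zero, if_neg (show ¬((∀ j ∈ l, j = i) ∧ i ∉ S) from fun h' => h h'.1),
      Matrix.zero_apply, Pi.zero_apply]

/-- The Koszul sign is a unit in any nontrivial ring: `ε(S,i) ≠ 0` in a field. [folklore] -/
private theorem koszulSign_cast_ne_zero (S : Finset (Fin q)) (i : Fin q) : (koszulSign S i : K) ≠ 0 := by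
  intro h
  have h1 := congrArg (fun z : ℤ => (z : K)) (koszulSign_mul_self S i)
  simp only [Int.cast_mul, Int.cast_one, h, mul_zero] at h1
  exact zero_ne_one h1

/-- The coordinate vectors `v ⊗ e_T` (`v ≠ 0` fixed, `T` running over distinct subsets) are linearly
independent. [folklore] -/
private theorem linearIndependent_single_subsets {M : Type*} [AddCommGroup M] [Module K M] {v : M} (hv : v ≠ 0)
    {P : Finset (Fin q) → Prop} :
    LinearIndependent K (fun T : {T : Finset (Fin q) // P T} => (Pi.single T.1 v : Finset (Fin q) → M)) := by
  classical
  rw [linearIndependent_iff']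
  intro s g hg T hT
  have h := congrFun hg T.1
  simp only [Finset.sum_apply, Pi.smul_apply, Pi.zero_apply] at h
  rw [Finset.sum_eq_single T] at h
  · rw [Pi.single_eq_same] at h
    exact (smul_eq_zero.1 h).resolve_right hv
  · intro T' _ hT'
    rw [Pi.single_eq_of_ne (fun h' => hT' (Subtype.ext h'.symm)), smul_zero]
  · intro h'
    exact absurd hT h'

/-- `#{T ⊆ Fin q : |T| = p + 1, i ∈ T} = binom(q - 1, p)` (remove `i`). [folklore] -/
private theorem card_subsets_succ_containing (i : Fin q) (p : ℕ) :
    Fintype.card {T : Finset (Fin q) // T.card = p + 1 ∧ i ∈ T} = (q - 1).choose p := by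
  classical
  rw [Fintype.card_subtype]
  have ht : (Finset.powersetCard p (Finset.univ.erase i)).card = (q - 1).choose p := by
    rw [Finset.card_powersetCard, Finset.card_erase_of_mem (Finset.mem_univ i), Finset.card_univ,
      Fintype.card_fin]
  rw [← ht]
  refine Finset.card_bij' (fun T _ => T.erase i) (fun S _ => insert i S) ?_ ?_ ?_ ?_
  · intro T hT
    rw [Finset.mem_filter] at hT
    rw [Finset.mem_powersetCard]
    refine ⟨fun x hx => ?_, ?_⟩
    · rw [Finset.mem_erase] at hx ⊢
      exact ⟨hx.1, Finset.mem_univ x⟩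
    · rw [Finset.card_erase_of_mem hT.2.2, hT.2.1, Nat.add_sub_cancel]
  · intro S hS
    rw [Finset.mem_powersetCard] at hS
    have hiS : i ∉ S := fun h => by simpa using hS.1 h
    rw [Finset.mem_filter]
    exact ⟨Finset.mem_univ _, by rw [Finset.card_insert_of_notMem hiS, hS.2], Finset.mem_insert_self i S⟩
  · intro T hT
    rw [Finset.mem_filter] at hT
    exact Finset.insert_erase hT.2.2
  · intro S hS
    rw [Finset.mem_powersetCard] at hS
    have hiS : i ∉ S := fun h => by simpa using hS.1 h
    exact Finset.erase_insert hiS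

/-- For `k < d` (characteristic `0`) the image of `(x_i^d)_{k,d-k}^{∧p}` is spanned by the
`x_i^{d-k-1} ⊗ e_T` with `|T| = p + 1`, `i ∈ T` (`= x_i^{d-k-1} ⊗ (x_i ∧ Λ^pV)`).
[cite: Guan2016, Lemma 2.9 (proof)] [cite: LandsbergGCT2017, §2.4.2 (image of a rank-one element is `a ∧ Λ^pA`)] -/
theorem span_kyImages_X_pow [CharZero K] (i : Fin q) {d k : ℕ} (p : ℕ) (hkd : k < d) :
    Submodule.span K (kyImages p k ((X i : MvPolynomial (Fin q) K) ^ d)) =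
      Submodule.span K (Set.range fun T : {T : Finset (Fin q) // T.card = p + 1 ∧ i ∈ T} =>
        (Pi.single T.1 (X i ^ (d - (k + 1))) : Finset (Fin q) → MvPolynomial (Fin q) K)) := by
  classical
  -- the scalar `ε(S,i) · d(d-1)⋯(d-k)` in front of each nonzero image
  have hc : (d.descFactorial (k + 1) : K) ≠ 0 := by
    rw [Nat.cast_ne_zero, Ne, Nat.descFactorial_eq_zero_iff_lt]
    omega
  have hcoef : ∀ (S : Finset (Fin q)) (w : MvPolynomial (Fin q) K),
      (koszulSign S i : MvPolynomial (Fin q) K) * ((d.descFactorial (k + 1) : K) • w) =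
        ((koszulSign S i : K) * (d.descFactorial (k + 1) : K)) • w := by
    intro S w
    rw [← map_intCast (C : K →+* MvPolynomial (Fin q) K), C_mul', smul_smul]
  apply le_antisymm
  · rw [Submodule.span_le]
    rintro g ⟨l, S, hl, hS, rfl⟩
    rw [kyImage_X_pow]
    split_ifs with h
    · rw [hl, hcoef, Pi.single_smul]
      refine Submodule.smul_mem _ _ (Submodule.subset_span ⟨⟨insert i S, ?_, Finset.mem_insert_self i S⟩, rfl⟩)
      rw [Finset.card_insert_of_notMem h.2, hS]
    · exact Submodule.zero_mem _
  · rw [Submodule.span_le]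
    rintro g ⟨⟨T, hT, hiT⟩, rfl⟩
    have hiS : i ∉ T.erase i := Finset.notMem_erase i T
    have himg : kyImage ((X i : MvPolynomial (Fin q) K) ^ d) (List.replicate k i) (T.erase i) =
        ((koszulSign (T.erase i) i : K) * (d.descFactorial (k + 1) : K)) •
          (Pi.single T (X i ^ (d - (k + 1))) : Finset (Fin q) → MvPolynomial (Fin q) K) := by
      rw [kyImage_X_pow, if_pos ⟨fun j hj => List.eq_of_mem_replicate hj, hiS⟩, List.length_replicate,
        Finset.insert_erase hiT, hcoef, Pi.single_smul]
    have hne : (koszulSign (T.erase i) i : K) * (d.descFactorial (k + 1) : K) ≠ 0 :=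
      mul_ne_zero (koszulSign_cast_ne_zero _ _) hc
    have hmem : kyImage ((X i : MvPolynomial (Fin q) K) ^ d) (List.replicate k i) (T.erase i) ∈
        Submodule.span K (kyImages p k ((X i : MvPolynomial (Fin q) K) ^ d)) :=
      Submodule.subset_span ⟨List.replicate k i, T.erase i, List.length_replicate, by
        rw [Finset.card_erase_of_mem hiT, hT, Nat.add_sub_cancel], rfl⟩
    rw [himg] at hmem
    have := Submodule.smul_mem _ ((koszulSign (T.erase i) i : K) * (d.descFactorial (k + 1) : K))⁻¹ hmem
    rwa [smul_smul, inv_mul_cancel₀ hne, one_smul] at this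

/-- **The rank-one value of the Koszul–Young flattening** (Guan, Lemma 2.9; the normaliser `r₀` of
Landsberg's Prop. 8.2.1.1, "the image is `a ∧ Λ^pA`"): for a pure power `x_i^d ∈ S^d K^q` and `k < d`,
in characteristic `0`, **`rank((x_i^d)_{k,d-k}^{∧p}) = binom(q - 1, p)`**. (Guan states it with
`dim V = d`; the dimension count is `#{T : |T| = p+1, i ∈ T}`.) [cite: Guan2016, Lemma 2.9]
[cite: LandsbergGCT2017, Prop. 8.2.1.1 (the rank `r₀` of the map associated to `ℓ^d`)] -/
theorem kyRankFin_X_pow [CharZero K] (i : Fin q) {d k : ℕ} (p : ℕ) (hkd : k < d) :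
    kyRankFin K p k ((X i : MvPolynomial (Fin q) K) ^ d) = (q - 1).choose p := by
  classical
  rw [kyRankFin, span_kyImages_X_pow i p hkd, finrank_span_eq_card, card_subsets_succ_containing]
  exact linearIndependent_single_subsets (pow_ne_zero _ (X_ne_zero i))

end PurePower


/-! ## Invariance under renumbering of the variables

A permutation `π` of the coordinates acts on `Λ^•K^q` by `e_S ↦ e_{π s₁} ∧ ⋯ ∧ e_{π s_p} = (−1)^{inv_π(S)} e_{π S}`
and on `S^kV^*` by `∂^l ↦ ∂^{π l}`; the Koszul–Young images of `rename π f` are the images of `f` transported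
by this signed permutation (`kyImage_rename`), so the rank is unchanged (`kyRankFin_rename`) and `kyRank` does
not depend on the numbering `Fintype.equivFin` (`kyRank_eq_kyRankFin_rename`). -/

section Rename

variable {K : Type*} [CommRing K] {q : ℕ}

/-- The number of inversions of the permutation `π` on the subset `S`: pairs `s < t` in `S` with
`π t < π s`. [folklore] -/
def invCount (π : Equiv.Perm (Fin q)) (S : Finset (Fin q)) : ℕ :=
  ∑ s ∈ S, (S.filter fun t => s < t ∧ π t < π s).card

/-- The sign with which `π` acts on the basis vector `e_S` of `Λ^•K^q`:
`e_{π s₁} ∧ ⋯ ∧ e_{π s_p} = renameSign π S · e_{π S}` for `S = {s₁ < ⋯ < s_p}`. [folklore] -/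
def renameSign (π : Equiv.Perm (Fin q)) (S : Finset (Fin q)) : ℤ :=
  (-1) ^ invCount π S

/-- Inversions of `π` on `S ∪ {j}`: those inside `S`, plus the pairs `(s, j)`, `s < j`, `π j < π s`,
plus the pairs `(j, t)`, `j < t`, `π t < π j`. [folklore] -/
private theorem invCount_insert (π : Equiv.Perm (Fin q)) {S : Finset (Fin q)} {j : Fin q} (hj : j ∉ S) :
    invCount π (insert j S) = invCount π S + (S.filter fun s => s < j ∧ π j < π s).card +
      (S.filter fun t => j < t ∧ π t < π j).card := by
  classical
  unfold invCount
  rw [Finset.sum_insert hj]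
  have h1 : ((insert j S).filter fun t => j < t ∧ π t < π j) = S.filter fun t => j < t ∧ π t < π j := by
    rw [Finset.filter_insert, if_neg (fun h => lt_irrefl _ h.1)]
  have h2 : ∀ s ∈ S, ((insert j S).filter fun t => s < t ∧ π t < π s).card =
      (S.filter fun t => s < t ∧ π t < π s).card + if s < j ∧ π j < π s then 1 else 0 := by
    intro s _
    rw [Finset.filter_insert]
    split_ifs with h
    · rw [Finset.card_insert_of_notMem (fun h' => hj (Finset.mem_filter.1 h').1)]
    · rfl
  rw [h1, Finset.sum_congr rfl h2, Finset.sum_add_distrib, Finset.sum_boole]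
  simp only [Nat.cast_id]
  ring

/-- **The Koszul sign transforms by the action on `Λ^•`:** for `j ∉ S`,
`ε(π S, π j) · ε(S, j) = renameSign π (S ∪ {j}) · renameSign π S`, i.e.
`Λ(π)(e_j ∧ e_S) = Λ(π)(e_j) ∧ Λ(π)(e_S)`. [folklore] -/
private theorem koszulSign_map_mul (π : Equiv.Perm (Fin q)) {S : Finset (Fin q)} {j : Fin q} (hj : j ∉ S) :
    koszulSign (S.map π.toEmbedding) (π j) * koszulSign S j =
      renameSign π (insert j S) * renameSign π S := by
  classical
  unfold koszulSign renameSign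
  rw [← pow_add, ← pow_add, invCount_insert π hj]
  have hmap : ((S.map π.toEmbedding).filter (· < π j)).card = (S.filter fun s => π s < π j).card := by
    rw [Finset.filter_map, Finset.card_map]
    rfl
  rw [hmap]
  have hne : ∀ s ∈ S, s ≠ j := fun s hs h => hj (h ▸ hs)
  -- `#{s < j} = A + B`
  have hsj : (S.filter (· < j)).card =
      (S.filter fun s => s < j ∧ π s < π j).card + (S.filter fun s => s < j ∧ π j < π s).card := by
    rw [← Finset.card_filter_add_card_filter_not (s := S.filter (· < j)) (fun s => π s < π j),
      Finset.filter_filter, Finset.filter_filter]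
    congr 2
    refine Finset.filter_congr fun s hs => ?_
    constructor
    · rintro ⟨h1, h2⟩
      exact ⟨h1, lt_of_le_of_ne (not_lt.1 h2) (fun h => hne s hs (π.injective h.symm))⟩
    · rintro ⟨h1, h2⟩
      exact ⟨h1, not_lt.2 h2.le⟩
  -- `#{π s < π j} = A + C`
  have hpj : (S.filter fun s => π s < π j).card =
      (S.filter fun s => s < j ∧ π s < π j).card + (S.filter fun t => j < t ∧ π t < π j).card := by
    rw [← Finset.card_filter_add_card_filter_not (s := S.filter fun s => π s < π j) (· < j),
      Finset.filter_filter, Finset.filter_filter]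
    congr 1
    · congr 1
      exact Finset.filter_congr fun s _ => and_comm
    · congr 1
      refine Finset.filter_congr fun s hs => ?_
      constructor
      · rintro ⟨h1, h2⟩
        exact ⟨lt_of_le_of_ne (not_lt.1 h2) (hne s hs).symm, h1⟩
      · rintro ⟨h1, h2⟩
        exact ⟨h2, not_lt.2 h1.le⟩
  rw [hsj, hpj]
  set A := (S.filter fun s => s < j ∧ π s < π j).card
  set B := (S.filter fun s => s < j ∧ π j < π s).card
  set C := (S.filter fun t => j < t ∧ π t < π j).card
  rw [show A + C + (A + B) = 2 * A + (B + C) by ring,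
    show invCount π S + B + C + invCount π S = 2 * invCount π S + (B + C) by ring]
  simp only [pow_add, pow_mul]
  norm_num

/-- A renumbered set renumbered back. [folklore] -/
private theorem map_map_symm (π : Equiv.Perm (Fin q)) (T : Finset (Fin q)) :
    (T.map π.toEmbedding).map π.symm.toEmbedding = T := by
  ext x
  simp [Finset.mem_map_equiv]

/-- And conversely. [folklore] -/
private theorem map_symm_map (π : Equiv.Perm (Fin q)) (T : Finset (Fin q)) :
    (T.map π.symm.toEmbedding).map π.toEmbedding = T := by
  ext x
  simp [Finset.mem_map_equiv]

/-- Iterated derivatives commute with injective renamings (Mathlib's `pderiv_rename`, iterated; the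
tree's `iterPDeriv_rename` lives in a heavier file). [folklore] -/
private theorem iterPDeriv_rename_inj {α σ : Type*} {g : α → σ} (hg : Function.Injective g) (l : List α)
    (p : MvPolynomial α K) :
    iterPDeriv (l.map g) (rename g p) = rename g (iterPDeriv l p) := by
  induction l with
  | nil => rfl
  | cons a l ih => rw [List.map_cons, iterPDeriv_cons, iterPDeriv_cons, ih, pderiv_rename hg]

/-- Chain rule for a renumbering: `∂_{π j} ∂^l (f ∘ π⁻¹) = (∂_j ∂^{π⁻¹ l} f) ∘ π⁻¹` (Mathlib's
`pderiv_rename`, iterated). [folklore] -/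
private theorem pderiv_iterPDeriv_rename (π : Equiv.Perm (Fin q)) (f : MvPolynomial (Fin q) K)
    (l : List (Fin q)) (j : Fin q) :
    pderiv (π j) (iterPDeriv l (rename π f)) =
      rename π (pderiv j (iterPDeriv (l.map π.symm) f)) := by
  have hl : l = (l.map π.symm).map π := by
    rw [List.map_map]
    simp
  conv_lhs => rw [hl]
  rw [iterPDeriv_rename_inj π.injective, pderiv_rename π.injective]

/-- **Transport of the Koszul–Young images under a renumbering `π` of the variables**:
the image of `∂^l ⊗ e_{π S}` for `rename π f`, read at `e_{π T}`, is `± rename π` of the image of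
`∂^{π⁻¹l} ⊗ e_S` for `f` read at `e_T`, with the sign `renameSign π T · renameSign π S` of the action of
`π` on `Λ^•` (coordinate form of the `GL(V)`-equivariance of (8.2.1) for permutation matrices).
[cite: LandsbergGCT2017, §8.2.1 (the map (8.2.1) "is a GL(V)-module map")] -/
theorem kyImage_rename (π : Equiv.Perm (Fin q)) (f : MvPolynomial (Fin q) K) (l : List (Fin q))
    (S T : Finset (Fin q)) :
    kyImage (rename π f) l (S.map π.toEmbedding) (T.map π.toEmbedding) =
      ((renameSign π T * renameSign π S : ℤ) : MvPolynomial (Fin q) K) *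
        rename π (kyImage f (l.map π.symm) S T) := by
  classical
  rw [kyImage_apply, kyImage_apply, map_sum, Finset.mul_sum, ← Equiv.sum_comp π]
  refine Finset.sum_congr rfl fun j _ => ?_
  have hmem : π j ∉ S.map π.toEmbedding ↔ j ∉ S := by
    rw [Finset.mem_map_equiv, Equiv.symm_apply_apply]
  have hins : T.map π.toEmbedding = insert (π j) (S.map π.toEmbedding) ↔ T = insert j S := by
    rw [show (π j) = π.toEmbedding j from rfl, ← Finset.map_insert,
      (Finset.map_injective π.toEmbedding).eq_iff]
  by_cases h : j ∉ S ∧ T = insert j S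
  · rw [if_pos (hmem.2 h.1 |> fun h1 => ⟨h1, hins.2 h.2⟩), if_pos h, pderiv_iterPDeriv_rename, map_mul,
      map_intCast]
    obtain ⟨hjS, rfl⟩ := h
    have key := koszulSign_map_mul π hjS
    have hsign : koszulSign (S.map π.toEmbedding) (π j) =
        renameSign π (insert j S) * renameSign π S * koszulSign S j := by
      calc koszulSign (S.map π.toEmbedding) (π j)
          = koszulSign (S.map π.toEmbedding) (π j) * (koszulSign S j * koszulSign S j) := by
            rw [koszulSign_mul_self, mul_one]
        _ = (koszulSign (S.map π.toEmbedding) (π j) * koszulSign S j) * koszulSign S j := by ring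
        _ = renameSign π (insert j S) * renameSign π S * koszulSign S j := by rw [key]
    rw [hsign]
    push_cast
    ring
  · rw [if_neg (fun h' => h ⟨hmem.1 h'.1, hins.1 h'.2⟩), if_neg h, map_zero, mul_zero]

end Rename

section RenameRank

variable {K : Type*} [Field K] {q : ℕ}

/-- The signed permutation of `Λ^•K^q ⊗ K[x]` induced by a renumbering `π` of the variables:
`(Ψ g)(e_{π T}) = renameSign π T · rename π (g(e_T))`. [folklore] -/
def renameKY (π : Equiv.Perm (Fin q)) :
    (Finset (Fin q) → MvPolynomial (Fin q) K) →ₗ[K] (Finset (Fin q) → MvPolynomial (Fin q) K) where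
  toFun g := fun T' => ((renameSign π (T'.map π.symm.toEmbedding) : ℤ) : K) •
    rename π (g (T'.map π.symm.toEmbedding))
  map_add' g h := by
    funext T'
    simp only [Pi.add_apply, map_add, smul_add]
  map_smul' c g := by
    funext T'
    simp only [Pi.smul_apply, RingHom.id_apply, MvPolynomial.smul_eq_C_mul, map_mul,
      MvPolynomial.rename_C]
    ring

/-- Unfolding lemma for `renameKY` at a renumbered index. [folklore] -/
private theorem renameKY_apply_map (π : Equiv.Perm (Fin q)) (g : Finset (Fin q) → MvPolynomial (Fin q) K)
    (T : Finset (Fin q)) :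
    renameKY π g (T.map π.toEmbedding) = ((renameSign π T : ℤ) : K) • rename π (g T) := by
  change ((renameSign π ((T.map π.toEmbedding).map π.symm.toEmbedding) : ℤ) : K) •
      rename π (g ((T.map π.toEmbedding).map π.symm.toEmbedding)) = _
  rw [map_map_symm]

/-- `kyImage_rename` as an identity of vectors: the image of `∂^l ⊗ e_{π S}` for `rename π f` is
`renameSign π S · Ψ_π(image of ∂^{π⁻¹ l} ⊗ e_S for f)`. [folklore] -/
private theorem kyImage_rename_eq_smul (π : Equiv.Perm (Fin q)) (f : MvPolynomial (Fin q) K) (l : List (Fin q))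
    (S : Finset (Fin q)) :
    kyImage (rename π f) l (S.map π.toEmbedding) =
      ((renameSign π S : ℤ) : K) • renameKY π (kyImage f (l.map π.symm) S) := by
  funext T'
  rw [Pi.smul_apply, ← map_symm_map π T', renameKY_apply_map, kyImage_rename, smul_smul,
    ← map_intCast (C : K →+* MvPolynomial (Fin q) K), C_mul', Int.cast_mul, mul_comm]

/-- The set of Koszul–Young images is finite (finitely many lists of length `k` and subsets).
[folklore] -/
private theorem kyImages_finite (p k : ℕ) (f : MvPolynomial (Fin q) K) : (kyImages p k f).Finite := by
  refine (Set.finite_range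
    (fun v : List.Vector (Fin q) k × Finset (Fin q) => kyImage f v.1.toList v.2)).subset ?_
  rintro g ⟨l, S, hl, -, rfl⟩
  exact ⟨(⟨l, hl⟩, S), rfl⟩

/-- The span of the Koszul–Young images (the image of the flattening) is finite-dimensional. [folklore] -/
instance finite_span_kyImages (p k : ℕ) (f : MvPolynomial (Fin q) K) :
    Module.Finite K (Submodule.span K (kyImages p k f)) :=
  Module.Finite.span_of_finite K (kyImages_finite p k f)

/-- The images of `rename π f` span a subspace of the `Ψ_π`-transport of the span of the images of
`f`. [folklore] -/
private theorem span_kyImages_rename_le (π : Equiv.Perm (Fin q)) (p k : ℕ) (f : MvPolynomial (Fin q) K) :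
    Submodule.span K (kyImages p k (rename π f)) ≤
      (Submodule.span K (kyImages p k f)).map (renameKY π) := by
  rw [Submodule.span_le]
  rintro g ⟨l, S', hl, hS', rfl⟩
  have hSeq : S' = (S'.map π.symm.toEmbedding).map π.toEmbedding := (map_symm_map π S').symm
  rw [hSeq, kyImage_rename_eq_smul]
  refine Submodule.smul_mem _ _ (Submodule.mem_map_of_mem (Submodule.subset_span
    ⟨l.map π.symm, S'.map π.symm.toEmbedding, by rw [List.length_map, hl],
      by rw [Finset.card_map]; exact hS', rfl⟩))

/-- **Renumbering the variables does not change the Koszul–Young rank** (one inequality).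
[folklore] -/
private theorem kyRankFin_rename_le (π : Equiv.Perm (Fin q)) (p k : ℕ) (f : MvPolynomial (Fin q) K) :
    kyRankFin K p k (rename π f) ≤ kyRankFin K p k f := by
  haveI : Module.Finite K (Submodule.span K (kyImages p k f)) :=
    Module.Finite.span_of_finite K (kyImages_finite p k f)
  unfold kyRankFin
  exact (Submodule.finrank_mono (span_kyImages_rename_le π p k f)).trans
    (Submodule.finrank_map_le _ _)

/-- **Renumbering the variables does not change the Koszul–Young rank**: for every permutation `π`
of `Fin q`, `rank((f ∘ π⁻¹)^{∧p}_{k,d−k}) = rank(f^{∧p}_{k,d−k})` (the flattening is transported by the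
signed permutation `Λ(π) ⊗ S(π)`, an isomorphism; a special case of `GL`-equivariance,
Landsberg §8.2.1: "(8.2.1) … is a GL(V)-module map"). [cite: LandsbergGCT2017, §8.2.1 (the map (8.2.1) is a `GL(V)`-module map)] -/
theorem kyRankFin_rename (π : Equiv.Perm (Fin q)) (p k : ℕ) (f : MvPolynomial (Fin q) K) :
    kyRankFin K p k (rename π f) = kyRankFin K p k f := by
  refine le_antisymm (kyRankFin_rename_le π p k f) ?_
  have h := kyRankFin_rename_le π.symm p k (rename π f)
  rwa [rename_rename, show ((π.symm : Fin q → Fin q) ∘ (π : Fin q → Fin q)) = id from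
    funext (fun x => π.symm_apply_apply x), rename_id] at h

/-- **`kyRank` does not depend on the numbering of the variables**: for ANY bijection
`e : σ ≃ Fin (card σ)` (not just `Fintype.equivFin σ`), `kyRank K p k f = kyRankFin K p k (rename e f)`.
[cite: LandsbergGCT2017, §8.2.1 (the map (8.2.1) is a `GL(V)`-module map)] -/
theorem kyRank_eq_kyRankFin_rename {σ : Type*} [Fintype σ] [DecidableEq σ] (e : σ ≃ Fin (Fintype.card σ))
    (p k : ℕ) (f : MvPolynomial σ K) :
    kyRank K p k f = kyRankFin K p k (rename e f) := by
  rw [kyRank_def]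
  have hfun : ((((Fintype.equivFin σ).symm.trans e) : Fin (Fintype.card σ) → Fin (Fintype.card σ)) ∘
      (Fintype.equivFin σ : σ → Fin (Fintype.card σ))) = (e : σ → Fin (Fintype.card σ)) := by
    funext x
    simp
  have : rename e f = rename ((Fintype.equivFin σ).symm.trans e)
      (rename (Fintype.equivFin σ) f) := by
    rw [rename_rename, hfun]
  rw [this, kyRankFin_rename]

end RenameRank

end Literature.Computability.AlgebraicComplexity
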